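import Summits.KontsevichZagierPeriods.KontsevichZagierPeriods.Theorems.RootDecompWalshStrataQuadricRung

/-!
# Route D `RootDecompWalshStrata` — the rung `d ≤ 4` of the quadric stratum (gen 11, node file)

Cell decomp-kz, lens 4 «minimal counterexample / extremal reduction», generation 11.  After gen 10 the
rung `d ≤ 3` of the Artin–Tate stratum is a THEOREM (`QuadricRung.quadricThree_holds`, part 65:
`QuadricBakerDescent` 27597 proved, Baker kernel in the tree).  The extremal reading of the next slice:
a minimal vanishing combination of weighted quadric Walsh cells that is NOT a relation has some cell of
dimension `d ≥ 4`; at `d = 4` the weight of the values jumps from `1` (`π`, `log`, `arctan` of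
quadratic irrationals) to `2` (`π²`, and a priori `Li₂` / Clausen / Catalan values), so the Baker
sector can no longer be the oracle.  The node typed here:

  `QuadricFour ⟸ QuadricTwoDescent ∧ RationalTwoKernel`   (`quadricFour_of_twoKernel_of_twoDescent`)

* `QuadricFour` — `QuadricSignKernel` (item 25393) restricted to `dᵢ ≤ 4` [WEAKER: `S ⟹` it
  (`quadricFour_of_summit`), `QuadricSignKernel ⟹` it; `⟹ QuadricThree` (27596)];
* `QuadricTwoDescent` — THE LEVER (moves only): every weighted quadric Walsh cell of dimension `≤ 4`
  is congruent modulo `KZ.relations` to the RATIONAL DIMENSION-`≤ 2` SECTOR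
  `AddSubgroup.closure {[N] : dim N ≤ 2, N.IsRational}` [THEOREM-TYPE, not formally `S`-implied
  (sector membership, not a value coincidence); its `d ≤ 3` slice follows from the PROVED item 27597
  (`twoDescentThree_of_bakerDescent`), so its content is the single slice `d = 4`
  (`QuadricTwoDescentFour`, `quadricTwoDescent_of_three_of_four`); first `d = 4` instance decided
  inside the rules: the companion files `RootDecompWalshStrataBall4*.lean` of this generation
  (the orthant of the 4-ball, value `q·π²/32`, lands on `[(0,1)², q/(8(1−2s+2s²)(1−2t+2t²))]`)];
* `RationalTwoKernel` — THE ORACLE: Conjecture 1 in kernel form on the rational dimension-`≤ 2`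
  sector [WEAKER: `S ⟹` it (`rationalTwoKernel_of_summit`); it `⟹ KZDimTwo` (item 4280, shared by
  routes AbelContraction / RootDecompQuadraticDescent / …, `kzDimTwo_of_rationalTwoKernel`) and it
  `⟹ PlanarSignKernel` (item 25394, `planarSignKernel_of_rationalTwoKernel`); UNDECIDED whether
  strictly weaker than `S`; leaf IDEA-NEEDED / BARRIER-adjacent = the weight-2 wall (indecomposable
  `Li₂` / Clausen / Catalan species; lens 6's pair #18 `ζ(2)` scissors is the decomposable corner)].

Everything here is pure logic over the route file's items (cited BY NAME through the landed
`RootDecompWalshStrataQuadricRung`); 0 sorry.  [KontsevichZagier2001 §1.2; Baker1975 Thm 2.1]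
-/

namespace Summit.KontsevichZagierPeriods.RootDecompWalshStrata.QuadricFourRung

open Literature.NumberTheory.Transcendental
open Summit.KontsevichZagierPeriods.KontsevichZagierPeriods.Theses.RootDecompWalshStrata
  (QuadricSignKernel PlanarSignKernel QuadricThree QuadricBakerDescent)

/-! ### The three pieces -/

/-- **`QuadricFour`** [piece · WEAKER (`S ⟹` it, `QuadricSignKernel ⟹` it) · UNDECIDED whether strictly
weaker]: every vanishing `ℤ`-combination of weighted quadric Walsh cells `(0,1)^{dᵢ} ∩ {Pᵢ > 0}`,
`deg Pᵢ ≤ 2`, `dᵢ ≤ 4`, constant rational integrands, is a Kontsevich–Zagier relation — the text of the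
route item `QuadricThree` (27596) with `3 ↦ 4`. [KontsevichZagier2001 §1.2] -/
@[conjecture] def QuadricFour : Prop :=
  ∀ (k : ℕ) (d : Fin k → ℕ) (P : (i : Fin k) → MvPolynomial (Fin (d i)) ℚ) (q : Fin k → ℚ)
    (ρ : (i : Fin k) → KZ.IntegralRep (d i)) (c : Fin k → ℤ),
    (∀ i, (ρ i).domain = {x | (∀ j, 0 < x j ∧ x j < 1) ∧ 0 < MvPolynomial.aeval x (P i)} ∧
      ∀ x ∈ (ρ i).domain, (ρ i).integrand x = (q i : ℝ)) →
    (∀ i, (P i).totalDegree ≤ 2) → (∀ i, d i ≤ 4) →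
    KZ.eval (∑ i, c i • KZ.of (ρ i)) = 0 → (∑ i, c i • KZ.of (ρ i)) ∈ KZ.relations

/-- **`QuadricTwoDescent`** [lever · THEOREM-TYPE · moves only · not formally `S`-implied]: every
weighted quadric Walsh cell of dimension `≤ 4` with constant rational integrand is congruent modulo
`KZ.relations` to an element of the rational dimension-`≤ 2` sector
`AddSubgroup.closure {[N] : dim N ≤ 2, N.IsRational}` — the text of the route item
`QuadricBakerDescent` (27597) with `m ≤ 1 ↦ m ≤ 2` and `d ≤ 3 ↦ d ≤ 4`. [KontsevichZagier2001 §1.2] -/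
@[conjecture] def QuadricTwoDescent : Prop :=
  ∀ (d : ℕ) (P : MvPolynomial (Fin d) ℚ) (q : ℚ) (ρ : KZ.IntegralRep d),
    (ρ.domain = {x | (∀ j, 0 < x j ∧ x j < 1) ∧ 0 < MvPolynomial.aeval x P} ∧
      ∀ x ∈ ρ.domain, ρ.integrand x = (q : ℝ)) →
    P.totalDegree ≤ 2 → d ≤ 4 →
    ∃ y ∈ AddSubgroup.closure
      {y : KZ.FormalRep | ∃ (m : ℕ) (N : KZ.IntegralRep m), m ≤ 2 ∧ N.IsRational ∧ y = KZ.of N},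
      KZ.of ρ - y ∈ KZ.relations

/-- **`QuadricTwoDescentFour`** [the NEW CONTENT of the lever: its slice `d = 4`; THEOREM-TYPE ·
ATTACKABLE-WITH-PLAN (fibrewise Dirichlet-polar slope charts `(u,v) ↦ (u(1−v), uv)` with Jacobian `u`,
two Newton–Leibniz moves with algebraic edges, no symmetry splitting; first instance PROVED = the
orthant of the 4-ball, files `RootDecompWalshStrataBall4{Chart,Band,Planar,Descent,Rung}.lean` of this
generation: `QuadricFourRung.quadricTwoDescentFourAt_ball4`)].
[KontsevichZagier2001 §1.2] -/
@[conjecture] def QuadricTwoDescentFour : Prop :=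
  ∀ (P : MvPolynomial (Fin 4) ℚ) (q : ℚ) (ρ : KZ.IntegralRep 4),
    (ρ.domain = {x | (∀ j, 0 < x j ∧ x j < 1) ∧ 0 < MvPolynomial.aeval x P} ∧
      ∀ x ∈ ρ.domain, ρ.integrand x = (q : ℝ)) →
    P.totalDegree ≤ 2 →
    ∃ y ∈ AddSubgroup.closure
      {y : KZ.FormalRep | ∃ (m : ℕ) (N : KZ.IntegralRep m), m ≤ 2 ∧ N.IsRational ∧ y = KZ.of N},
      KZ.of ρ - y ∈ KZ.relations

/-- **`RationalTwoKernel`** [oracle · WEAKER (`S ⟹` it) · UNDECIDED whether strictly weaker · leaf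
IDEA-NEEDED / BARRIER-adjacent (weight-2 wall)]: Conjecture 1 in kernel form on the rational
dimension-`≤ 2` sector — every vanishing `ℤ`-combination of classes of KZ-rational representations of
dimensions `≤ 2` is a relation.  It implies the shared pair-form item `KZDimTwo` (4280) and the route's
planar stratum `PlanarSignKernel` (25394). [KontsevichZagier2001 §1.2; HuberMullerStach2017 Conj. 13.2.1] -/
@[conjecture] def RationalTwoKernel : Prop :=
  ∀ ⦃x : KZ.FormalRep⦄, x ∈ AddSubgroup.closure
      {y : KZ.FormalRep | ∃ (m : ℕ) (N : KZ.IntegralRep m), m ≤ 2 ∧ N.IsRational ∧ y = KZ.of N} →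
    KZ.eval x = 0 → x ∈ KZ.relations

/-! ### The glue: `RationalTwoKernel → QuadricTwoDescent → QuadricFour` -/

/-- **THE NODE.** Descend each cell of a vanishing `ℤ`-combination into the rational dimension-`≤ 2`
sector (`hD`); the descended combination has value `0` because relations evaluate to `0`
(`KZ.relations_le_ker_eval_holds`), hence is a relation by the oracle (`hK`), and the original
combination differs from it by relations.  Port of the landed
`QuadricRung.quadricThree_of_bakerKernel_of_bakerDescent` with `1 ↦ 2`, `3 ↦ 4`.
[KontsevichZagier2001 §1.2] -/
theorem quadricFour_of_twoKernel_of_twoDescent (hK : RationalTwoKernel) (hD : QuadricTwoDescent) :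
    QuadricFour := by
  intro k d P q ρ c hρ hdeg hd hv
  choose y hy hrel using fun i => hD (d i) (P i) (q i) (ρ i) (hρ i) (hdeg i) (hd i)
  have h1 : (∑ i, c i • KZ.of (ρ i)) - ∑ i, c i • y i ∈ KZ.relations := by
    rw [← Finset.sum_sub_distrib]
    exact AddSubgroup.sum_mem _ fun i _ => by
      rw [← smul_sub]; exact AddSubgroup.zsmul_mem _ (hrel i) _
  have h2 : (∑ i, c i • y i) ∈ AddSubgroup.closure
      {y : KZ.FormalRep | ∃ (m : ℕ) (N : KZ.IntegralRep m), m ≤ 2 ∧ N.IsRational ∧ y = KZ.of N} :=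
    AddSubgroup.sum_mem _ fun i _ => AddSubgroup.zsmul_mem _ (hy i) _
  have h3 : KZ.eval (∑ i, c i • y i) = 0 := by
    have h := KZ.relations_le_ker_eval_holds h1
    rw [AddMonoidHom.mem_ker, map_sub, hv, zero_sub, neg_eq_zero] at h
    exact h
  have h4 := hK h2 h3
  have := KZ.relations.add_mem h1 h4
  simpa using this

/-! ### Edges to the route's items -/

/-- The rung `d ≤ 4` is a specialisation of the stratum piece: `QuadricSignKernel → QuadricFour`.
[KontsevichZagier2001 §1.2] -/
theorem quadricFour_of_quadricSignKernel (hQ : QuadricSignKernel) : QuadricFour :=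
  fun k d P q ρ c hρ hdeg _ hv => hQ k d P q ρ c hρ hdeg hv

/-- The rung `d ≤ 4` contains the rung `d ≤ 3`: `QuadricFour → QuadricThree` (item 27596).
[KontsevichZagier2001 §1.2] -/
theorem quadricThree_of_quadricFour (h4 : QuadricFour) : QuadricThree :=
  fun k d P q ρ c hρ hdeg hd hv => h4 k d P q ρ c hρ hdeg (fun i => (hd i).trans (by norm_num)) hv

/-- The `d ≤ 3` slice of the lever is carried by the PROVED item `QuadricBakerDescent` (27597): the
Baker sector lies in the rational dimension-`≤ 2` sector. [Baker1975 Thm 2.1; KontsevichZagier2001 §1.2] -/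
theorem twoDescentThree_of_bakerDescent (hB : QuadricBakerDescent) :
    ∀ (d : ℕ) (P : MvPolynomial (Fin d) ℚ) (q : ℚ) (ρ : KZ.IntegralRep d),
      (ρ.domain = {x | (∀ j, 0 < x j ∧ x j < 1) ∧ 0 < MvPolynomial.aeval x P} ∧
        ∀ x ∈ ρ.domain, ρ.integrand x = (q : ℝ)) →
      P.totalDegree ≤ 2 → d ≤ 3 →
      ∃ y ∈ AddSubgroup.closure
        {y : KZ.FormalRep | ∃ (m : ℕ) (N : KZ.IntegralRep m), m ≤ 2 ∧ N.IsRational ∧ y = KZ.of N},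
        KZ.of ρ - y ∈ KZ.relations := by
  intro d P q ρ hρ hdeg hd
  obtain ⟨y, hy, hrel⟩ := hB d P q ρ hρ hdeg hd
  refine ⟨y, AddSubgroup.closure_mono ?_ hy, hrel⟩
  rintro _ ⟨m, N, hm, hN, rfl⟩
  exact ⟨m, N, hm.trans (by norm_num), hN, rfl⟩

/-- **The lever splits as (PROVED `d ≤ 3` slice) + (`d = 4` slice)**:
`QuadricBakerDescent → QuadricTwoDescentFour → QuadricTwoDescent`. [KontsevichZagier2001 §1.2] -/
theorem quadricTwoDescent_of_three_of_four (hB : QuadricBakerDescent) (h4 : QuadricTwoDescentFour) :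
    QuadricTwoDescent := by
  intro d P q ρ hρ hdeg hd
  rcases Nat.lt_or_ge d 4 with hlt | hge
  · exact twoDescentThree_of_bakerDescent hB d P q ρ hρ hdeg (by omega)
  · obtain rfl : d = 4 := le_antisymm hd hge
    exact h4 P q ρ hρ hdeg

/-- Conversely the `d = 4` slice is a specialisation of the lever. [KontsevichZagier2001 §1.2] -/
theorem quadricTwoDescentFour_of_twoDescent (hD : QuadricTwoDescent) : QuadricTwoDescentFour :=
  fun P q ρ hρ hdeg => hD 4 P q ρ hρ hdeg le_rfl

/-! ### Necessity: `S ⟹` each value-piece (the kernel form of Conjecture 1 is in the tree) -/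

/-- `S ⟹` the kernel form of Conjecture 1 (`eval c = 0 → c ∈ KZ.relations`), by the tree's
`KontsevichZagierPeriods_iff` and `kzKernelConjecture_iff_isRational`. [KontsevichZagier2001 §1.2] -/
private theorem kernel_of_summit (hS : _root_.KontsevichZagierPeriods) :
    ∀ c : KZ.FormalRep, KZ.eval c = 0 → c ∈ KZ.relations :=
  kzKernelConjecture_iff_isRational.mpr (KontsevichZagierPeriods_iff.mp hS)

/-- `S ⟹ QuadricFour` (the piece is WEAKER than the summit). [KontsevichZagier2001 §1.2] -/
theorem quadricFour_of_summit (hS : _root_.KontsevichZagierPeriods) : QuadricFour :=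
  fun _k _d _P _q _ρ _c _ _ _ h => kernel_of_summit hS _ h

/-- `S ⟹ RationalTwoKernel` (the oracle is WEAKER than the summit). [KontsevichZagier2001 §1.2] -/
theorem rationalTwoKernel_of_summit (hS : _root_.KontsevichZagierPeriods) : RationalTwoKernel :=
  fun _x _ h => kernel_of_summit hS _ h

/-! ### The oracle dominates the shared floor `KZDimTwo` (4280) and the planar stratum (25394) -/

/-- **`RationalTwoKernel → KZDimTwo`** (conclusion = the signature of the shared item
stmt-KontsevichZagierPeriods-4280 VERBATIM): apply the kernel statement to `[r] − [r']`.
[KontsevichZagier2001 §1.2] -/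
theorem kzDimTwo_of_rationalTwoKernel (hK : RationalTwoKernel) :
    ∀ ⦃n m : ℕ⦄, n ≤ 2 → m ≤ 2 → ∀ (r : KZ.IntegralRep n) (r' : KZ.IntegralRep m),
      r.IsRational → r'.IsRational → r.value = r'.value → KZ.Equivalent r r' := by
  intro n m hn hm r r' hr hr' hv
  refine hK (sub_mem (AddSubgroup.subset_closure ⟨n, r, hn, hr, rfl⟩)
    (AddSubgroup.subset_closure ⟨m, r', hm, hr', rfl⟩)) ?_
  rw [KZ.eval_of_sub_of, hv, sub_self]

/-- A Walsh cell with CONSTANT rational integrand has KZ's literal (rational) shape (`p = C q`,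
`q = 1`). [KontsevichZagier2001 §1.1] -/
theorem isRational_of_const {d : ℕ} (ρ : KZ.IntegralRep d) (q : ℚ)
    (h : ∀ x ∈ ρ.domain, ρ.integrand x = (q : ℝ)) : ρ.IsRational := by
  refine ⟨MvPolynomial.C q, 1, fun x _ => by simp, fun x hx => ?_⟩
  simp only [h x hx, MvPolynomial.aeval_C, eq_ratCast, map_one, div_one]

/-- **`RationalTwoKernel → PlanarSignKernel`** (item 25394): planar Walsh cells with constant rational
integrands are KZ-rational representations of dimension `≤ 2`. [KontsevichZagier2001 §1.2] -/
theorem planarSignKernel_of_rationalTwoKernel (hK : RationalTwoKernel) : PlanarSignKernel := by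
  intro k d P q ρ c hρ hd hv
  have hmem : ∀ i, KZ.of (ρ i) ∈ AddSubgroup.closure
      {y : KZ.FormalRep | ∃ (m : ℕ) (N : KZ.IntegralRep m), m ≤ 2 ∧ N.IsRational ∧ y = KZ.of N} :=
    fun i => AddSubgroup.subset_closure ⟨d i, ρ i, hd i, isRational_of_const (ρ i) (q i) (hρ i).2, rfl⟩
  exact hK (AddSubgroup.sum_mem _ fun i _ => AddSubgroup.zsmul_mem _ (hmem i) _) hv

/-! ### Bookkeeping: the node restated as one implication chain, and its place in route D -/

/-- The node as a chain: `RationalTwoKernel → QuadricBakerDescent → QuadricTwoDescentFour → QuadricFour`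
(with 27597 proved, the live inputs are the oracle and the `d = 4` slice). [KontsevichZagier2001 §1.2] -/
theorem quadricFour_of_twoKernel_of_bakerDescent_of_four (hK : RationalTwoKernel)
    (hB : QuadricBakerDescent) (h4 : QuadricTwoDescentFour) : QuadricFour :=
  quadricFour_of_twoKernel_of_twoDescent hK (quadricTwoDescent_of_three_of_four hB h4)

end Summit.KontsevichZagierPeriods.RootDecompWalshStrata.QuadricFourRung
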